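import Summits.CriticalPhenomena.PercolationContinuityZ3.Theorems.PercNearOneGluingAdditiveGluingBhkMenu
import Summits.CriticalPhenomena.PercolationContinuityZ3.Theorems.PercNearOneGluingAdditiveGluingBhkSets
import Literature.Probability.Percolation.KozmaNitzanPreFKG
import HarnessLib

/-!
# `NoHeavyLowerTail` (stmt-CriticalPhenomena-4575) — TRANSPORT ROWS: worst-ness of a relay survives mixed conditioning
# on `{a_w ↮ X} ∩ U`, `U` increasing in the cluster of the SET `X ∪ {a_j}`

Support file (new-inequality factory, all-graph proof seat `prim-ineq-prove-4`; `--supports stmt-CriticalPhenomena-4575`).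
No definitions, no named facts, no sorries; standard axioms.

THE ROW (`TransportRow.transportRow`).  Bond percolation on a finite weighted graph, `μ = prodBernoulli w`; relays
`a_w, a_j` with `a_w` WORSE than `a_j` towards the sink `b` (`μ{a_w ↔ b} ≤ μ{a_j ↔ b}`); a vertex set `X ∌ a_w`;
`T = X ∪ {a_j}`; an event `U` cut out by an up-set `𝓖` of edge sets at the open edge cluster `C_T = ⋃_{t∈T} C_t`
(i.e. `U` is increasing in, and read off, the cluster of the set `T`).  Then
  `μ({a_w ↔ b} ∩ {a_w ↮ X} ∩ U) ≤ μ({a_j ↔ b} ∩ {a_w ↮ X} ∩ U)`.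
Special cases: plain worst-ness (`X = ∅`, `U = Ω`); Kozma–Nitzan Lemma 3(i) (`X = ∅`, `U` increasing in `C_{a_j}`);
Lemma 3(ii) with `Q = {a_w ↮ X}` (`U = Ω`); the "mixed" rows `M1–M4` of the factory notes (e.g. `X = {o}`,
`U = {o ↔ {a_2,a_3}}`).  These rows are LINEAR in the cell law given the worst-relay order, so in the LP / `CertGeneral`
certificate format they are hypothesis rows (`LinRow`) costing no multiplier degree — the point of this file.

PROOF (as in the notes `Transport rows`, all tools landed): remove the common part `{a_w ↔ b ↔ a_j}` — what is
left of either side lives on `N = {a_w ↮ T}`; on the `a_w`-side BHK Thm 1.4 for the clusters of `{a_w}` and `T`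
given `N` (`bhkMenu_two` fed with the second half of `stub_bhkSets`): `μ(N) μ(N ∩ a_w↔b ∩ U) ≤ μ(N ∩ a_w↔b) μ(N ∩ U)`;
on the `a_j`-side BHK Thm 1.3 for the cluster of the set `T` given `T ↮ a_w` (`bhkMenu_one`, first half of
`stub_bhkSets`): `μ(N ∩ a_j↔b) μ(N ∩ U) ≤ μ(N) μ(N ∩ a_j↔b ∩ U)`; in between Kozma–Nitzan Lemma 3(ii) with the
decreasing event `N` of `C_{a_w}` (`KozmaNitzan2024_lemma3_ii_notConn`): `μ(N ∩ a_w↔b) ≤ μ(N ∩ a_j↔b)`.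
[cite: VandenbergHaggstromKahn2005, Thm. 1.3 (p. 6), Thm. 1.4 (p. 7)] [cite: KozmaNitzan2024, Lemma 3 (pp. 6–7)]
-/

namespace Summit.CriticalPhenomena.PercolationContinuityZ3.Theorems

open MeasureTheory Set Literature.Probability.Percolation
open Literature.Probability.LatticeModels (prodBernoulli)

noncomputable section
open Classical

variable {n : ℕ}

namespace TransportRow

/-- The two-set separation event `{ {a_w} ↮ T }` is `{a_w ↮ T}`. [folklore] -/
theorem sep_two_eq (aw : Fin n) (T : Finset (Fin n)) :
    {ω : BondConfig (Fin n) | ∀ s ∈ ({aw} : Finset (Fin n)), ∀ x ∈ T, ¬ (openGraph ω).Reachable s x} =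
      {ω | ∀ x ∈ T, ¬ (openGraph ω).Reachable aw x} := by
  ext ω
  simp only [Set.mem_setOf_eq, Finset.mem_singleton, forall_eq]

/-- The one-set separation event `{T ↮ {a_w}}` is `{a_w ↮ T}`. [folklore] -/
theorem sep_one_eq (aw : Fin n) (T : Finset (Fin n)) :
    {ω : BondConfig (Fin n) | ∀ s ∈ T, ∀ x ∈ ({aw} : Set (Fin n)), ¬ (openGraph ω).Reachable s x} =
      {ω | ∀ x ∈ T, ¬ (openGraph ω).Reachable aw x} := by
  ext ω
  simp only [Set.mem_setOf_eq, Set.mem_singleton_iff, forall_eq]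
  exact ⟨fun h x hx hr => h x hx hr.symm, fun h x hx hr => h x hx hr.symm⟩

/-- The Lemma-3(ii) conditioning event `{a_w ↮ ↑T}` is `{a_w ↮ T}`. [folklore] -/
theorem sep_coe_eq (aw : Fin n) (T : Finset (Fin n)) :
    {ω : BondConfig (Fin n) | ∀ u ∈ (T : Set (Fin n)), ¬ (openGraph ω).Reachable aw u} =
      {ω | ∀ x ∈ T, ¬ (openGraph ω).Reachable aw x} := by
  ext ω
  simp only [Set.mem_setOf_eq, Finset.mem_coe]

/-- On `{a_w ↔ a_j}` the events `{a_w ↔ b}` and `{a_j ↔ b}` coincide (inside any event `R`). [folklore] -/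
theorem conn_inter_reach_eq (aw aj b : Fin n) (R : Set (BondConfig (Fin n))) :
    (openConn aw b : Set (BondConfig (Fin n))) ∩ R ∩ openConn aw aj =
      (openConn aj b : Set (BondConfig (Fin n))) ∩ R ∩ openConn aw aj := by
  ext ω
  simp only [openConn, Set.mem_inter_iff, Set.mem_setOf_eq]
  constructor
  · rintro ⟨⟨hb, hR⟩, hj⟩
    exact ⟨⟨hj.symm.trans hb, hR⟩, hj⟩
  · rintro ⟨⟨hb, hR⟩, hj⟩
    exact ⟨⟨hj.trans hb, hR⟩, hj⟩

/-- Splitting off `{a_w ↔ a_j}`: `E ∩ {a_w ↮ X} ∩ U` minus `{a_w ↔ a_j}` is `{a_w ↮ X ∪ {a_j}} ∩ (E ∩ U)`. [folklore] -/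
theorem diff_reach_eq (aw aj : Fin n) (X : Finset (Fin n)) (E U : Set (BondConfig (Fin n))) :
    (E ∩ {ω : BondConfig (Fin n) | ∀ x ∈ X, ¬ (openGraph ω).Reachable aw x} ∩ U) \ openConn aw aj =
      {ω : BondConfig (Fin n) | ∀ x ∈ insert aj X, ¬ (openGraph ω).Reachable aw x} ∩ (E ∩ U) := by
  ext ω
  simp only [openConn, Set.mem_sdiff, Set.mem_inter_iff, Set.mem_setOf_eq, Finset.forall_mem_insert]
  tauto

/-- **Transport row.**  `a_w` worse than `a_j` (`μ{a_w ↔ b} ≤ μ{a_j ↔ b}`), `a_w ∉ X`, `a_w ≠ a_j`, `U` cut out by an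
up-set `𝓖` at the open edge cluster of `T = X ∪ {a_j}` ⟹ `μ({a_w ↔ b} ∩ {a_w ↮ X} ∩ U) ≤ μ({a_j ↔ b} ∩ {a_w ↮ X} ∩ U)`.
[cite: VandenbergHaggstromKahn2005, Thm. 1.3 (p. 6), Thm. 1.4 (p. 7)] [cite: KozmaNitzan2024, Lemma 3 (pp. 6–7)] -/
theorem transportRow (w : Sym2 (Fin n) → unitInterval) (aw aj b : Fin n) (X : Finset (Fin n))
    (haw : aw ∉ X) (hwj : aw ≠ aj)
    (𝓖 : Set (Set (Sym2 (Fin n)))) (h𝓖 : IsUpperSet 𝓖) (U : Set (BondConfig (Fin n)))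
    (hU : ∀ ω : BondConfig (Fin n), (⋃ s ∈ insert aj X, openEdgeCluster ω s) ∈ 𝓖 ↔ ω ∈ U)
    (hworst : (prodBernoulli w).real (openConn aw b) ≤ (prodBernoulli w).real (openConn aj b)) :
    (prodBernoulli w).real
        ((openConn aw b : Set (BondConfig (Fin n))) ∩ {ω | ∀ x ∈ X, ¬ (openGraph ω).Reachable aw x} ∩ U) ≤
      (prodBernoulli w).real
        ((openConn aj b : Set (BondConfig (Fin n))) ∩ {ω | ∀ x ∈ X, ¬ (openGraph ω).Reachable aw x} ∩ U) := by
  set μ := prodBernoulli w with hμ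
  set T : Finset (Fin n) := insert aj X with hT
  set N : Set (BondConfig (Fin n)) := {ω | ∀ x ∈ T, ¬ (openGraph ω).Reachable aw x} with hN
  set Ew : Set (BondConfig (Fin n)) := openConn aw b with hEw
  set Ej : Set (BondConfig (Fin n)) := openConn aj b with hEj
  set NX : Set (BondConfig (Fin n)) := {ω | ∀ x ∈ X, ¬ (openGraph ω).Reachable aw x} with hNX
  -- side conditions
  have hdisj : Disjoint ({aw} : Finset (Fin n)) T := by
    rw [Finset.disjoint_singleton_left, hT, Finset.mem_insert, not_or]
    exact ⟨hwj, haw⟩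
  have hTX : ∀ s ∈ T, s ∉ ({aw} : Set (Fin n)) := by
    intro s hs hs'
    rw [Set.mem_singleton_iff] at hs'
    subst hs'
    exact Finset.disjoint_singleton_left.1 hdisj hs
  -- step A: BHK Thm 1.4 for the clusters of {a_w} and T given N
  have hA := bhkMenu_two stub_bhkSets.2 w {aw} T
    {C : Set (Sym2 (Fin n)) | (openGraph C).Reachable aw b} 𝓖 (bhkMenu_pt_isUpperSet aw b) h𝓖 Ew U
    (fun ω => bhkMenu_pt_mem {aw} (Finset.mem_singleton_self aw) b ω) hU hdisj
  rw [sep_two_eq] at hA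
  -- step B: BHK Thm 1.3 for the cluster of the set T given T ↮ a_w
  have hB := bhkMenu_one stub_bhkSets.1 w T ({aw} : Set (Fin n))
    {C : Set (Sym2 (Fin n)) | (openGraph C).Reachable aj b} 𝓖 (bhkMenu_pt_isUpperSet aj b) h𝓖 Ej U
    (fun ω => bhkMenu_pt_mem T (Finset.mem_insert_self aj X) b ω) hU hTX
  rw [sep_one_eq] at hB
  -- step C: Kozma–Nitzan Lemma 3(ii) with the decreasing event N of C_{a_w}
  have hC := KozmaNitzan2024_lemma3_ii_notConn w aw aj b (T : Set (Fin n)) hworst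
  rw [sep_coe_eq, Set.inter_comm Ew, Set.inter_comm Ej] at hC
  -- the conditioned comparison
  have hcond : μ.real (N ∩ (Ew ∩ U)) ≤ μ.real (N ∩ (Ej ∩ U)) := by
    have hu : 0 ≤ μ.real (N ∩ U) := measureReal_nonneg
    rcases eq_or_lt_of_le (measureReal_nonneg : 0 ≤ μ.real N) with hm | hm
    · have h1 : μ.real (N ∩ (Ew ∩ U)) ≤ μ.real N := measureReal_mono Set.inter_subset_left
      linarith [measureReal_nonneg (μ := μ) (s := N ∩ (Ej ∩ U))]
    · have hchain : μ.real N * μ.real (N ∩ (Ew ∩ U)) ≤ μ.real N * μ.real (N ∩ (Ej ∩ U)) :=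
        calc μ.real N * μ.real (N ∩ (Ew ∩ U)) ≤ μ.real (N ∩ Ew) * μ.real (N ∩ U) := hA
          _ ≤ μ.real (N ∩ Ej) * μ.real (N ∩ U) := mul_le_mul_of_nonneg_right hC hu
          _ ≤ μ.real N * μ.real (N ∩ (Ej ∩ U)) := hB
      exact le_of_mul_le_mul_left hchain hm
  -- unconditioning: add back the common part on {a_w ↔ a_j}
  have hsw : μ.real (Ew ∩ NX ∩ U ∩ openConn aw aj) + μ.real ((Ew ∩ NX ∩ U) \ openConn aw aj) =
      μ.real (Ew ∩ NX ∩ U) :=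
    measureReal_inter_add_sdiff (μ := μ) (s := Ew ∩ NX ∩ U) MeasurableSet.of_discrete
  have hsj : μ.real (Ej ∩ NX ∩ U ∩ openConn aw aj) + μ.real ((Ej ∩ NX ∩ U) \ openConn aw aj) =
      μ.real (Ej ∩ NX ∩ U) :=
    measureReal_inter_add_sdiff (μ := μ) (s := Ej ∩ NX ∩ U) MeasurableSet.of_discrete
  rw [diff_reach_eq, ← hT, ← hN] at hsw hsj
  have e1 : Ew ∩ NX ∩ U ∩ openConn aw aj = Ej ∩ NX ∩ U ∩ openConn aw aj := by
    rw [Set.inter_assoc Ew, Set.inter_assoc Ej, hEw, hEj]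
    exact conn_inter_reach_eq aw aj b (NX ∩ U)
  rw [e1] at hsw
  linarith [hcond, hsw, hsj]

/-- The up-set `{C | ∀ v ∈ W, ∃ t ∈ T, t ↔ v in C}` ("all of `W` joined to `T`"). [folklore] -/
theorem allJoined_isUpperSet (T W : Finset (Fin n)) :
    IsUpperSet {C : Set (Sym2 (Fin n)) | ∀ v ∈ W, ∃ t ∈ T, (openGraph C).Reachable t v} := by
  intro C C' hCC' hC v hv
  obtain ⟨t, ht, hr⟩ := hC v hv
  exact ⟨t, ht, hr.mono (openGraph_mono hCC')⟩

/-- At `C = C_T(ω)` the up-set "all of `W` joined to `T`" cuts out `⋂_{v∈W} ⋃_{t∈T} {t ↔ v}`. [folklore] -/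
theorem allJoined_mem (T W : Finset (Fin n)) (ω : BondConfig (Fin n)) :
    (⋃ s ∈ T, openEdgeCluster ω s) ∈
        {C : Set (Sym2 (Fin n)) | ∀ v ∈ W, ∃ t ∈ T, (openGraph C).Reachable t v} ↔
      ω ∈ ⋂ v ∈ W, ⋃ t ∈ T, (openConn t v : Set (BondConfig (Fin n))) := by
  simp only [Set.mem_setOf_eq, Set.mem_iInter, Set.mem_iUnion, exists_prop]
  constructor
  · intro h v hv
    obtain ⟨t, ht, hr⟩ := h v hv
    exact ⟨t, ht, (knThm2_reachable_biUnion_iff T ht v ω).1 hr⟩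
  · intro h v hv
    obtain ⟨t, ht, hr⟩ := h v hv
    exact ⟨t, ht, (knThm2_reachable_biUnion_iff T ht v ω).2 hr⟩

/-- The up-set `{C | ∃ v ∈ W, ∃ t ∈ T, t ↔ v in C}` ("some of `W` joined to `T`"). [folklore] -/
theorem someJoined_isUpperSet (T W : Finset (Fin n)) :
    IsUpperSet {C : Set (Sym2 (Fin n)) | ∃ v ∈ W, ∃ t ∈ T, (openGraph C).Reachable t v} := by
  intro C C' hCC' hC
  obtain ⟨v, hv, t, ht, hr⟩ := hC
  exact ⟨v, hv, t, ht, hr.mono (openGraph_mono hCC')⟩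

/-- At `C = C_T(ω)` the up-set "some of `W` joined to `T`" cuts out `⋃_{v∈W} ⋃_{t∈T} {t ↔ v}`. [folklore] -/
theorem someJoined_mem (T W : Finset (Fin n)) (ω : BondConfig (Fin n)) :
    (⋃ s ∈ T, openEdgeCluster ω s) ∈
        {C : Set (Sym2 (Fin n)) | ∃ v ∈ W, ∃ t ∈ T, (openGraph C).Reachable t v} ↔
      ω ∈ ⋃ v ∈ W, ⋃ t ∈ T, (openConn t v : Set (BondConfig (Fin n))) := by
  simp only [Set.mem_setOf_eq, Set.mem_iUnion, exists_prop]
  constructor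
  · rintro ⟨v, hv, t, ht, hr⟩
    exact ⟨v, hv, t, ht, (knThm2_reachable_biUnion_iff T ht v ω).1 hr⟩
  · rintro ⟨v, hv, t, ht, hr⟩
    exact ⟨v, hv, t, ht, (knThm2_reachable_biUnion_iff T ht v ω).2 hr⟩

/-- **Transport row, "all of `W` joined to `T`":** `μ({a_w↔b} ∩ {a_w↮X} ∩ ⋂_{v∈W} {v ↔ T}) ≤ μ({a_j↔b} ∩ {a_w↮X} ∩ ⋂_{v∈W} {v ↔ T})`,
`T = X ∪ {a_j}`. [cite: VandenbergHaggstromKahn2005, Thm. 1.3 (p. 6), Thm. 1.4 (p. 7)] [cite: KozmaNitzan2024, Lemma 3 (pp. 6–7)] -/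
theorem transportRow_all (w : Sym2 (Fin n) → unitInterval) (aw aj b : Fin n) (X W : Finset (Fin n))
    (haw : aw ∉ X) (hwj : aw ≠ aj)
    (hworst : (prodBernoulli w).real (openConn aw b) ≤ (prodBernoulli w).real (openConn aj b)) :
    (prodBernoulli w).real
        ((openConn aw b : Set (BondConfig (Fin n))) ∩ {ω | ∀ x ∈ X, ¬ (openGraph ω).Reachable aw x} ∩
          ⋂ v ∈ W, ⋃ t ∈ insert aj X, (openConn t v : Set (BondConfig (Fin n)))) ≤
      (prodBernoulli w).real
        ((openConn aj b : Set (BondConfig (Fin n))) ∩ {ω | ∀ x ∈ X, ¬ (openGraph ω).Reachable aw x} ∩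
          ⋂ v ∈ W, ⋃ t ∈ insert aj X, (openConn t v : Set (BondConfig (Fin n)))) :=
  transportRow w aw aj b X haw hwj _ (allJoined_isUpperSet (insert aj X) W) _
    (allJoined_mem (insert aj X) W) hworst

/-- **Transport row, "some of `W` joined to `T`":** `μ({a_w↔b} ∩ {a_w↮X} ∩ ⋃_{v∈W} {v ↔ T}) ≤ μ({a_j↔b} ∩ {a_w↮X} ∩ ⋃_{v∈W} {v ↔ T})`,
`T = X ∪ {a_j}`. [cite: VandenbergHaggstromKahn2005, Thm. 1.3 (p. 6), Thm. 1.4 (p. 7)] [cite: KozmaNitzan2024, Lemma 3 (pp. 6–7)] -/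
theorem transportRow_some (w : Sym2 (Fin n) → unitInterval) (aw aj b : Fin n) (X W : Finset (Fin n))
    (haw : aw ∉ X) (hwj : aw ≠ aj)
    (hworst : (prodBernoulli w).real (openConn aw b) ≤ (prodBernoulli w).real (openConn aj b)) :
    (prodBernoulli w).real
        ((openConn aw b : Set (BondConfig (Fin n))) ∩ {ω | ∀ x ∈ X, ¬ (openGraph ω).Reachable aw x} ∩
          ⋃ v ∈ W, ⋃ t ∈ insert aj X, (openConn t v : Set (BondConfig (Fin n)))) ≤
      (prodBernoulli w).real
        ((openConn aj b : Set (BondConfig (Fin n))) ∩ {ω | ∀ x ∈ X, ¬ (openGraph ω).Reachable aw x} ∩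
          ⋃ v ∈ W, ⋃ t ∈ insert aj X, (openConn t v : Set (BondConfig (Fin n)))) :=
  transportRow w aw aj b X haw hwj _ (someJoined_isUpperSet (insert aj X) W) _
    (someJoined_mem (insert aj X) W) hworst

end TransportRow

end

end Summit.CriticalPhenomena.PercolationContinuityZ3.Theorems
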